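import Mathlib.Topology.Order.DenselyOrdered
import Mathlib.Topology.Order.OrderClosed
import Summits.CriticalPhenomena.SAWScalingLimit.Theorems.SAWTotalPositivityBoundaryTP2Defs
import Summits.CriticalPhenomena.SAWScalingLimit.Theorems.SAWTotalPositivityBoundaryTP2Kernel
import Literature.Probability.RandomPlanarGeometry.SelfAvoidingWalkProofs
import HarnessLib

/-!
# Crux `BoundaryTP2` (stmt-CriticalPhenomena-7115), line `Sketch`: TP₂ at `x_c` from TP₂ below `x_c`

The combinatorial core of the crux is `GraphTP2At x_c` (`SAWTotalPositivityBoundaryTP2Defs`): the TP₂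
inequality `Z(p₁,p₃) Z(p₂,p₄) ≤ Z(p₁,p₂) Z(p₃,p₄)` for the fugacity-`x_c` self-avoiding path kernels
`Z = pathKernel H x_c` of every subgraph `H ≤ ℤ²` with finitely many non-isolated vertices and every
interlaced, disjointly realisable quadruple. This file records the continuity remark
`graphTP2At_criticalFugacity_of_subcritical`: TP₂ at every SUBCRITICAL fugacity `0 < x < x_c` already
gives TP₂ at `x_c`.

Proof. Fix `H` and the quadruple. `H` has finitely many self-avoiding paths between any two vertices
(`finite_path`), so each kernel is a finite sum `Σ_γ x^{|γ|}` (`pathKernel_eq_sum`), i.e. for `x ≥ 0` it is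
`ENNReal.ofReal` of the real polynomial value `P_{ab}(x) = Σ_γ x^{|γ|} ≥ 0` (`pathKernel_eq_ofReal_pathSum`),
and the `ℝ≥0∞` inequality at `x ≥ 0` is equivalent to the real one `P₁₃ P₂₄ ≤ P₁₂ P₃₄`. Both sides are
continuous in `x` (finite sums of powers), the inequality holds on `(0, x_c)` by hypothesis, and
`x_c ∈ closure (0, x_c) = [0, x_c]` because `x_c > 0` (`SAW.criticalFugacity_pos_lt_one'`, unconditional);
conclude with `le_on_closure`. [folklore]
-/

noncomputable section

namespace Summit.CriticalPhenomena.SAWScalingLimit.Theorems.BoundaryTP2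

open SimpleGraph Literature.Probability.LatticeModels Literature.Probability.RandomPlanarGeometry
open scoped ENNReal

variable {V : Type*} {H : SimpleGraph V}

/-- The real path polynomial `Σ_γ x^{|γ|}` of a graph with finitely many paths `a → b` is nonnegative
for `x ≥ 0`. [folklore] -/
theorem pathSum_nonneg {x : ℝ} (hx : 0 ≤ x) (a b : V) [Fintype (H.Path a b)] :
    0 ≤ ∑ γ : H.Path a b, x ^ γ.1.length :=
  Finset.sum_nonneg fun _ _ => pow_nonneg hx _

/-- For `x ≥ 0` the `ℝ≥0∞`-valued path kernel is `ENNReal.ofReal` of the real path polynomial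
`Σ_γ x^{|γ|}`. [folklore] -/
theorem pathKernel_eq_ofReal_pathSum {x : ℝ} (hx : 0 ≤ x) (a b : V) [Fintype (H.Path a b)] :
    pathKernel H x a b = ENNReal.ofReal (∑ γ : H.Path a b, x ^ γ.1.length) := by
  rw [pathKernel_eq_sum, ENNReal.ofReal_sum_of_nonneg fun _ _ => pow_nonneg hx _]

/-- The real path polynomial `x ↦ Σ_γ x^{|γ|}` is continuous (a finite sum of powers). [folklore] -/
theorem continuous_pathSum (a b : V) [Fintype (H.Path a b)] :
    Continuous fun x : ℝ => ∑ γ : H.Path a b, x ^ γ.1.length :=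
  continuous_finsetSum _ fun γ _ => continuous_pow γ.1.length

/-- For `x ≥ 0`, the TP₂ inequality of the `ℝ≥0∞` kernels is equivalent to the TP₂ inequality of the
real path polynomials. [folklore] -/
theorem pathKernel_tp2_iff {x : ℝ} (hx : 0 ≤ x) (p₁ p₂ p₃ p₄ : V) [Fintype (H.Path p₁ p₃)]
    [Fintype (H.Path p₂ p₄)] [Fintype (H.Path p₁ p₂)] [Fintype (H.Path p₃ p₄)] :
    pathKernel H x p₁ p₃ * pathKernel H x p₂ p₄ ≤ pathKernel H x p₁ p₂ * pathKernel H x p₃ p₄ ↔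
      (∑ γ : H.Path p₁ p₃, x ^ γ.1.length) * (∑ γ : H.Path p₂ p₄, x ^ γ.1.length) ≤
        (∑ γ : H.Path p₁ p₂, x ^ γ.1.length) * (∑ γ : H.Path p₃ p₄, x ^ γ.1.length) := by
  rw [pathKernel_eq_ofReal_pathSum hx, pathKernel_eq_ofReal_pathSum hx,
    pathKernel_eq_ofReal_pathSum hx, pathKernel_eq_ofReal_pathSum hx,
    ← ENNReal.ofReal_mul (pathSum_nonneg hx _ _), ← ENNReal.ofReal_mul (pathSum_nonneg hx _ _),
    ENNReal.ofReal_le_ofReal_iff (mul_nonneg (pathSum_nonneg hx _ _) (pathSum_nonneg hx _ _))]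

/-- **TP₂ at `x_c` from TP₂ below `x_c`.** If the combinatorial core `GraphTP2At x` holds at every
subcritical fugacity `0 < x < x_c`, then it holds at `x_c`: for a fixed finite instance both sides of the
inequality are continuous (polynomial) in `x`, and `x_c > 0` is a limit of subcritical fugacities.
[folklore] -/
theorem graphTP2At_criticalFugacity_of_subcritical
    (h : ∀ x : ℝ, 0 < x → x < SAW.criticalFugacity → GraphTP2At x) :
    GraphTP2At SAW.criticalFugacity := by
  intro H hH hfin p₁ p₂ p₃ p₄ hI hD₁ hD₂
  have hxc : 0 < SAW.criticalFugacity := SAW.criticalFugacity_pos_lt_one'.1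
  haveI : ∀ a b, Fintype (H.Path a b) := fun a b =>
    @Fintype.ofFinite (H.Path a b) (finite_path hfin a b)
  rw [pathKernel_tp2_iff hxc.le]
  -- the real inequality on `(0, x_c)`, from the hypothesis applied to the same instance
  have hsub : ∀ x ∈ Set.Ioo 0 SAW.criticalFugacity,
      (∑ γ : H.Path p₁ p₃, x ^ γ.1.length) * (∑ γ : H.Path p₂ p₄, x ^ γ.1.length) ≤
        (∑ γ : H.Path p₁ p₂, x ^ γ.1.length) * (∑ γ : H.Path p₃ p₄, x ^ γ.1.length) := by
    intro x hx
    exact (pathKernel_tp2_iff hx.1.le p₁ p₂ p₃ p₄).1 (h x hx.1 hx.2 H hH hfin p₁ p₂ p₃ p₄ hI hD₁ hD₂)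
  -- pass to the closed endpoint `x_c ∈ closure (0, x_c)`
  have hmem : SAW.criticalFugacity ∈ closure (Set.Ioo 0 SAW.criticalFugacity) := by
    rw [closure_Ioo hxc.ne]
    exact ⟨hxc.le, le_rfl⟩
  exact le_on_closure (f := fun x : ℝ =>
      (∑ γ : H.Path p₁ p₃, x ^ γ.1.length) * (∑ γ : H.Path p₂ p₄, x ^ γ.1.length))
    (g := fun x : ℝ => (∑ γ : H.Path p₁ p₂, x ^ γ.1.length) * (∑ γ : H.Path p₃ p₄, x ^ γ.1.length))
    hsub ((continuous_pathSum p₁ p₃).mul (continuous_pathSum p₂ p₄)).continuousOn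
    ((continuous_pathSum p₁ p₂).mul (continuous_pathSum p₃ p₄)).continuousOn hmem

end Summit.CriticalPhenomena.SAWScalingLimit.Theorems.BoundaryTP2
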